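import Summits.QuantumFields.YangMills.Theorems.UnitScaleTiltProp7LinearCorrectorBound
import Summits.QuantumFields.YangMills.Theorems.UnitScaleTiltProp7CentreHarmonicRegaugeSupT3
import Literature.MathematicalPhysics.QuantumFieldTheory.Balaban1983to89.B9TorusCalculus
import HarnessLib

/-!
# Route `UnitScaleTilt`, crux K1 «MinimiserStabilityRegPr» (stmt-QuantumFields-19200), route-R E′ path (α′), (E1-b) — SANITY: THE DOOR'S FIRST-ORDER ROW (hK) IS INHABITED AT THE TRIVIAL
# BACKGROUND by the flat chain.  At `U ≡ 1` the covariant letters of ✓ `Prop7LinearCorrectorBound.linCorr_gauge_le_of_rows` (`covD`, `divB ∘ covD`, `divB`, `Pi` sup norms) ARE the flat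
# `LatticeFieldCalculus` letters at lattice factor `c = 1` (`pdiff 1`, `laplace 1`, `diverg 1`), so ✓p671212 `exists_hInterp_const` gives the row `hK` with `c_I := Φ` (one absolute constant)

Cell `ym3-torus`, D-0154 (3c) twin-width seat `ym-routeR-w3` (gen 6), namer of the (hK)∕(A)∕(E1-b) lineage.  WHY: the (E1-b) door (✓p671456) displays two rows whose covariant suppliers are in
flight (P-cov2, routeR-w6 g6; (hK₂-cov), px7∕px11); this file checks BY KERNEL that the door's currencies coincide with the suppliers' flat model at `W = 1` — any letter mismatch between
✓p653652∕✓p654411∕✓p669951∕✓p671212 (flat, `grad c ∕ laplace c ∕ diverg c`) and ✓p655977∕✓p670099∕✓p671456 (covariant, `covD ∕ divB`) would surface here, not at knit time.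
THEOREMS ONLY (0 `def`, 0 `sorry`); `--supports stmt-QuantumFields-19200`, count-neutral.  YM₃ on T³ is a ladder rung (R3), not the Clay problem; nothing here claims the stub, the crux, d = 4 or the gap.

WHAT IS PROVED (ns `…Theorems.Prop7LinearCorrectorBoundFlat`).
* §1 DICTIONARY at `U ≡ 1` on `T^{(j)}` (any ring `𝔸` with an `ℝ`-module structure): `covD_one_eq_grad` (`D_{1,μ}f(x) = (∂_1 f)⟨x,μ⟩`), `divB_one_eq_diverg` (`D*_1A(x) = (∂^*_1A′)(x)`, `A′ b := A b.dir b.src`),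
  `covLaplace_one_eq_laplace` (`divB_1(D_1 f)(x) = (Δ_1 f)(x)`).
* §2 ★★ `hK_row_at_one` — for `d = 3`, `1 ≤ k ≤ m + K`, `40 ≤ sitesPerDir k`, a nontrivial real normed algebra `𝔸`: with ✓p671212's absolute `Φ`, every `φ`, every pinned interpolant `φ_H` of `φ|_C`
  (`C = range (embIter k)`) that is `Δ_1`-biharmonic off `C` IN THE COVARIANT LETTERS, and every bond field `A` with `Δ_1φ = D*_1A` satisfy the door's row
  `∀ μ x, ‖covD (torusT P 0) 1 μ (φ − φ_H) x‖ ≤ Φ·L^k·‖fun x => divB (torusT P 0) 1 A x‖` — i.e. `hK` of ✓ `linCorr_gauge_le_of_rows` at `U := 1` with `c_I := Φ`, for `L A := φ − φ_H`.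
HONEST SCOPE.  A consistency check, not a new estimate; the curved row is P-cov2.  Constants ours; nothing of print beyond the cited tree letters is asserted.

References: T. Bałaban, CMP 99 (1985) 389–434 [Balaban1985BackgroundPropagators] ((3.3) p.390, (3.8) p.392); CMP 95 (1984) 17–40 [Balaban1984PropagatorsI] ((1.2)–(1.4) p.18, (1.21) p.21);
CMP 99 (1985) 75–102 [Balaban1985RegularSpaces] ((1.36) p.82).
-/

set_option autoImplicit false

noncomputable section

open scoped BigOperators

namespace Summit.QuantumFields.YangMills.Theorems.Prop7LinearCorrectorBoundFlat

open Literature.MathematicalPhysics.QuantumFieldTheory.Balaban1983to89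
open LatticeFieldCalculus
open B9Eq39Adjoint (covD covDstar divB)
open B9TorusCalculus (torusT torusT_apply)
open B15DeterminingSets (embIter)
open Summit.QuantumFields.YangMills.Theorems.Prop7CentreHarmonicRegaugeSupT3 (exists_hInterp_const)

/-! ## §1 The dictionary at `U ≡ 1` -/

section Dictionary

variable {P : Params} {j : ℕ} {𝔸 : Type*} [Ring 𝔸] [Module ℝ 𝔸]

/-- `D_{1,μ}f(x) = (∂_1 f)⟨x, μ⟩` (✓ `covD_one`, `grad 1`). [cite: Balaban1985BackgroundPropagators, (3.3) p.390; Balaban1984PropagatorsI, (1.4) p.18] -/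
theorem covD_one_eq_grad (μ : Fin P.d) (f : Site P j → 𝔸) (x : Site P j) :
    covD (torusT P j) (fun _ _ => (1 : 𝔸ˣ)) μ f x = grad 1 f ⟨x, μ⟩ := by
  rw [B9TorusCalculus.covD_one, grad, one_smul]
  rfl

/-- `D*_1 A(x) = (∂^*_1 A′)(x)` with `A′ b := A b.dir b.src` (✓ `covDstar_one`, `diverg 1`). [cite: Balaban1985BackgroundPropagators, (3.8) p.392; Balaban1984PropagatorsI, (1.21) p.21] -/
theorem divB_one_eq_diverg (A : Fin P.d → Site P j → 𝔸) (x : Site P j) :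
    divB (torusT P j) (fun _ _ => (1 : 𝔸ˣ)) A x = diverg 1 (fun b : PBond P j => A b.dir b.src) x := by
  simp only [divB, B9TorusCalculus.covDstar_one, diverg, one_smul]

/-- `divB_1 (D_1 f)(x) = (Δ_1 f)(x)` — the covariant Laplacian at the trivial background is the flat Laplacian at lattice factor `1`.
[cite: Balaban1985BackgroundPropagators, (3.8) p.392; Balaban1984PropagatorsI, (1.21) p.21] -/
theorem covLaplace_one_eq_laplace (f : Site P j → 𝔸) (x : Site P j) :
    divB (torusT P j) (fun _ _ => (1 : 𝔸ˣ)) (fun μ => covD (torusT P j) (fun _ _ => (1 : 𝔸ˣ)) μ f) x = laplace 1 f x := by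
  simp only [divB, B9TorusCalculus.covDstar_one, laplace, one_pow, one_smul]
  refine Finset.sum_congr rfl fun μ _ => ?_
  rw [B9TorusCalculus.covD_one, B9TorusCalculus.covD_one,
    show (x.unshift μ).shift μ = x from (shiftEquiv (P := P) (j := j) μ).apply_symm_apply x]
  abel

end Dictionary

/-! ## §2 ★★ The row (hK) of the (E1-b) door at `W = 1` -/

/-- ★★ **THE DOOR'S FIRST-ORDER ROW, INHABITED AT THE TRIVIAL BACKGROUND.**  There is an absolute `Φ` (✓p671212's) such that for every run `P` with `d = 3`, `1 ≤ k ≤ m + K`, `40 ≤ sitesPerDir k`,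
every nontrivial real normed algebra `𝔸`, every site field `φ`, every `φ_H` agreeing with `φ` on `range (embIter k)` and covariantly biharmonic off it AT `U ≡ 1`, and every bond field `A` with
`Δ_1φ = D*_1A`: `‖D_{1,μ}(φ − φ_H)(x)‖ ≤ Φ·L^k·‖D*_1A‖_∞` at every `(μ, x)` — the hypothesis `hK` of ✓ `Prop7LinearCorrectorBound.linCorr_gauge_le_of_rows` at `U := 1`, `c_I := Φ`.
[cite: Balaban1985RegularSpaces, (1.36) p.82; Balaban1985BackgroundPropagators, (3.8) p.392] -/
theorem hK_row_at_one : ∃ Φ : ℝ, ∀ (P : Params) (_ : P.d = 3) (k : ℕ) (_ : k ≤ P.m + P.K) (_ : 1 ≤ k) (_ : 40 ≤ P.sitesPerDir k)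
    (𝔸 : Type) [NormedRing 𝔸] [NormedAlgebra ℝ 𝔸] [Nontrivial 𝔸]
    (φ φH : Site P 0 → 𝔸), (∀ y ∈ Set.range (embIter (P := P) k), φH y = φ y) →
    (∀ z ∉ Set.range (embIter (P := P) k),
      divB (torusT P 0) (fun _ _ => (1 : 𝔸ˣ)) (fun μ => covD (torusT P 0) (fun _ _ => (1 : 𝔸ˣ)) μ
        (fun y => divB (torusT P 0) (fun _ _ => (1 : 𝔸ˣ)) (fun ν => covD (torusT P 0) (fun _ _ => (1 : 𝔸ˣ)) ν φH) y)) z = 0) →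
    ∀ (A : Fin P.d → Site P 0 → 𝔸),
    (∀ x, divB (torusT P 0) (fun _ _ => (1 : 𝔸ˣ)) (fun μ => covD (torusT P 0) (fun _ _ => (1 : 𝔸ˣ)) μ φ) x = divB (torusT P 0) (fun _ _ => (1 : 𝔸ˣ)) A x) →
    ∀ (μ : Fin P.d) (x : Site P 0),
      ‖covD (torusT P 0) (fun _ _ => (1 : 𝔸ˣ)) μ (fun y => φ y - φH y) x‖ ≤ Φ * (P.L : ℝ) ^ k * ‖(fun x => divB (torusT P 0) (fun _ _ => (1 : 𝔸ˣ)) A x)‖ := by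
  obtain ⟨Φ, hΦ⟩ := exists_hInterp_const
  refine ⟨Φ, ?_⟩
  intro P hd k hk hk1 hM 𝔸 _ _ _ φ φH hH hEL A hφ μ x
  -- the biharmonic row in flat letters
  have hEL' : ∀ z ∉ Set.range (embIter (P := P) k), laplace 1 (laplace 1 φH) z = 0 := by
    intro z hz
    have h := hEL z hz
    have e1 : (fun y => divB (torusT P 0) (fun _ _ => (1 : 𝔸ˣ)) (fun ν => covD (torusT P 0) (fun _ _ => (1 : 𝔸ˣ)) ν φH) y) = laplace 1 φH :=
      funext fun y => covLaplace_one_eq_laplace φH y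
    rw [e1, covLaplace_one_eq_laplace] at h
    exact h
  -- the sup bound of `Δ_1φ = D*_1A` in the `Pi` norm
  have hs₁ : ∀ z, ‖laplace 1 φ z‖ ≤ ‖(fun x => divB (torusT P 0) (fun _ _ => (1 : 𝔸ˣ)) A x)‖ := by
    intro z
    rw [← covLaplace_one_eq_laplace φ z, hφ z]
    exact norm_le_pi_norm (fun x => divB (torusT P 0) (fun _ _ => (1 : 𝔸ˣ)) A x) z
  obtain ⟨hI, -⟩ := hΦ P hd k hk hk1 1 one_ne_zero hM 𝔸 φ φH hH hEL' _ hs₁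
  have h := hI ⟨x, μ⟩
  rw [abs_one, div_one] at h
  rw [covD_one_eq_grad]
  exact h

end Summit.QuantumFields.YangMills.Theorems.Prop7LinearCorrectorBoundFlat

end
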